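import Mathlib
import Summits.MatrixMultiplication.MatrixMultiplication.Theorems.SubgroupIdentityDesigns.Negative.TorusCube

/-!
# Level of a linear character = minimal rank on its affine dual coset
(negative lemma + exactness, crux `SubgroupIdentityDesigns`, stmt-MatrixMultiplication-14079; cell B2b-5)

Level `k` on `M_m(𝔽_p)`: `f = Σ_{rk M ≤ k} c_M ψ(tr(M·))` (`fourierMat`).  Let `T : M_m(𝔽_p) →+ M_m(𝔽_p)` be any
additive map (its image `𝔫 = T(M_m)` is an arbitrary additive subgroup of matrices, each point `n ∈ 𝔫` hit
`|ker T|` times) and `λ : M_m(𝔽_p) →+ 𝔽_p` any additive form; the points are `1 + T e` and the "linear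
character" is `e ↦ ψ(λ(T e))`.  The AFFINE DUAL COSET of `λ` is `{M : tr(M · T e) = λ(T e) ∀ e}` (a translate of
the annihilator `𝔫^⊥` for the trace pairing).

* `sum_psi_addMonoidHom_eq_zero` — orthogonality on `(M_m(𝔽_p), +)`: `Σ_e ψ(L e) = 0` for an additive
  `L ≠ 0`. [folklore]
* `affineDual_sum_eq_zero` — if NO matrix of rank `≤ k` lies on the affine dual coset of `λ`, then the weight
  `e ↦ ψ(−λ(T e)) δ_{1 + T e}` annihilates every level-`k` function: `Σ_e ψ(−λ(T e)) f(1 + T e) = 0`.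
* `no_idTest_of_affineDual` — hence no level-`k` function is `1` at `1` and `0` on the rest of any set
  `S ⊇ {1 + T e}`.  NO group structure on `{1 + T e}` is needed.
* `levelLE_of_affineDual_witness` — EXACTNESS: conversely a rank-`≤ k` point `M₀` of the coset gives the
  level-`k` function `ψ(−tr M₀) ψ(tr(M₀ ·))`, which restricts to `1 + 𝔫` as the character `ψ(λ(·))`.  So for an
  algebra group `1 + 𝔫` and a linear character `ψ ∘ λ`, the level (least `k` with the character inside
  `ℂ[M_{m×k}(𝔽_p)]`, cf. `Negative.UnitriangularLevel`) is EXACTLY the minimal rank on the affine dual coset.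
  (`Negative.RootSmear`, `Negative.UnitriangularLevel(Sharp)` are instances with a pattern group and a clever `λ`.)
* `succ_le_rank_of_gridCoset` / `no_idTest_of_patGrid` / `no_levelK_design_of_patGrid` — the explicit instance
  that is new: a position set `Pos` containing a TRANSPOSED `(k+1) × (k+1)` GRID `{(γ j, ρ i)}` (`ρ, γ` injective);
  with `λ(n) = Σ_l n_{γ l, ρ l}` every coset point `M` has `M.submatrix ρ γ = 1`, so `rk M ≥ k + 1`.  Consequently, if `H₁` contains every
  unipotent supported on a strictly-lower `Pos ⊇` such a grid — e.g. the ABELIAN unipotent radical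
  `{[[1,0],[X,1]] : X ∈ M_{b×a}(𝔽_p)}` of a maximal parabolic as soon as `min(a,b) ≥ k + 1` — then `(H₁, H₂, H₃)`
  admits no level-`k` identity design, for any `H₂, H₃` and any prime `p`; no TPP, torus (`TorusCube`) or
  triangle (`RootSmear`, `UnitriangularLevel`) is needed, and the wall `|H₁| ≤ #{rk ≤ k}` does not see it
  (`p^{(k+1)²}` versus `≈ p^{k(2m−k)}`).  Informally: the identity-test level of that radical is `min(a,b)`.
Sorry-free; standard axioms.  VALUE = theorem (a filter for design searches), not summit progress.
-/

set_option linter.dupNamespace false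

noncomputable section

open scoped BigOperators Classical

namespace Summit.MatrixMultiplication.MatrixMultiplication.Theorems.SubgroupIdentityDesigns.Negative

variable {p m : ℕ} [Fact p.Prime]

/-- Orthogonality on the additive group of matrices: a non-zero additive form has character sum `0`.
[folklore] -/
theorem sum_psi_addMonoidHom_eq_zero (L : CMat p m →+ ZMod p) (e₀ : CMat p m) (he₀ : L e₀ ≠ 0) :
    ∑ e : CMat p m, (ZMod.stdAddChar (L e) : ℂ) = 0 := by
  set ψL : AddChar (CMat p m) ℂ := (ZMod.stdAddChar (N := p)).compAddMonoidHom L with hψL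
  have hne : ψL ≠ 1 := by
    intro h
    apply he₀
    have h1 : (ZMod.stdAddChar (L e₀) : ℂ) = ZMod.stdAddChar (0 : ZMod p) := by
      rw [AddChar.map_zero_eq_one]
      have := DFunLike.congr_fun h e₀
      simpa [hψL] using this
    exact ZMod.injective_stdAddChar h1
  have := AddChar.sum_eq_zero_of_ne_one hne
  simpa [hψL] using this

/-- **THE AFFINE-DUAL ANNIHILATOR.**  If no matrix of rank `≤ k` lies on the affine dual coset
`{M : tr(M · T e) = λ(T e) ∀ e}`, then `Σ_e ψ(−λ(T e)) f(1 + T e) = 0` for every level-`k` function `f`. -/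
theorem affineDual_sum_eq_zero (k : ℕ) (T : CMat p m →+ CMat p m) (lam : CMat p m →+ ZMod p)
    (hrank : ∀ M : CMat p m, M.rank ≤ k → ∃ e : CMat p m, Matrix.trace (M * T e) ≠ lam (T e))
    (c : CMat p m → ℂ) (hc : ∀ M : CMat p m, k < M.rank → c M = 0) :
    ∑ e : CMat p m, (ZMod.stdAddChar (- lam (T e)) : ℂ) * fourierMat c (1 + T e) = 0 := by
  -- the additive form `L_M(e) = tr(M · T e) − λ(T e)`
  let L : CMat p m → CMat p m →+ ZMod p := fun M =>
    AddMonoidHom.mk' (fun e => Matrix.trace (M * T e) - lam (T e)) (by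
      intro x y
      simp only [map_add, Matrix.mul_add, Matrix.trace_add]
      ring)
  have hL : ∀ M e, L M e = Matrix.trace (M * T e) - lam (T e) := fun M e => rfl
  have hterm : ∀ e M : CMat p m,
      (ZMod.stdAddChar (- lam (T e)) : ℂ) * (c M * ZMod.stdAddChar (Matrix.trace (M * (1 + T e)))) =
        c M * ZMod.stdAddChar (Matrix.trace M) * ZMod.stdAddChar (L M e) := by
    intro e M
    rw [hL, Matrix.mul_add, Matrix.mul_one, Matrix.trace_add, sub_eq_add_neg, AddChar.map_add_eq_mul,
      AddChar.map_add_eq_mul]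
    ring
  calc (∑ e : CMat p m, (ZMod.stdAddChar (- lam (T e)) : ℂ) * fourierMat c (1 + T e))
      = ∑ e : CMat p m, ∑ M : CMat p m,
          c M * ZMod.stdAddChar (Matrix.trace M) * ZMod.stdAddChar (L M e) := by
        refine Finset.sum_congr rfl fun e _ => ?_
        rw [fourierMat, Finset.mul_sum]
        exact Finset.sum_congr rfl fun M _ => hterm e M
    _ = ∑ M : CMat p m, c M * ZMod.stdAddChar (Matrix.trace M) *
          ∑ e : CMat p m, (ZMod.stdAddChar (L M e) : ℂ) := by
        rw [Finset.sum_comm]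
        exact Finset.sum_congr rfl fun M _ => by rw [Finset.mul_sum]
    _ = 0 := by
        refine Finset.sum_eq_zero fun M _ => ?_
        by_cases hr : M.rank ≤ k
        · obtain ⟨e₀, he₀⟩ := hrank M hr
          rw [sum_psi_addMonoidHom_eq_zero (L M) e₀ (by rw [hL]; exact sub_ne_zero.2 he₀), mul_zero]
        · rw [hc M (by omega), zero_mul, zero_mul]

/-- **NO LEVEL-`k` IDENTITY TEST ON A SET CONTAINING `1 + 𝔫` WHEN A CHARACTER OF `𝔫` HAS NO RANK-`≤ k`
DUAL POINT.**  (`S` arbitrary; `{1 + T e}` need not be a group.) -/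
theorem no_idTest_of_affineDual (k : ℕ) (T : CMat p m →+ CMat p m) (lam : CMat p m →+ ZMod p)
    (hrank : ∀ M : CMat p m, M.rank ≤ k → ∃ e : CMat p m, Matrix.trace (M * T e) ≠ lam (T e))
    (S : Set (CMat p m)) (hS : ∀ e : CMat p m, 1 + T e ∈ S)
    (c : CMat p m → ℂ) (hc : ∀ M : CMat p m, k < M.rank → c M = 0)
    (h1 : fourierMat c 1 = 1) (h0 : ∀ s ∈ S, s ≠ 1 → fourierMat c s = 0) : False := by
  have hsum := affineDual_sum_eq_zero k T lam hrank c hc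
  have hval : ∀ e : CMat p m, (ZMod.stdAddChar (- lam (T e)) : ℂ) * fourierMat c (1 + T e) =
      if T e = 0 then 1 else 0 := by
    intro e
    by_cases he : T e = 0
    · rw [if_pos he, he, add_zero, map_zero, neg_zero, AddChar.map_zero_eq_one, h1, one_mul]
    · have hne1 : (1 : CMat p m) + T e ≠ 1 := fun h => he (by simpa using h)
      rw [if_neg he, h0 _ (hS e) hne1, mul_zero]
  simp_rw [hval] at hsum
  rw [Finset.sum_ite, Finset.sum_const_zero, add_zero, Finset.sum_const, nsmul_eq_mul, mul_one] at hsum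
  have hpos : 0 < (Finset.univ.filter fun e : CMat p m => T e = 0).card :=
    Finset.card_pos.2 ⟨0, by simp⟩
  exact absurd hsum (Nat.cast_ne_zero.2 hpos.ne')

/-- **EXACTNESS.**  A rank-`≤ k` point `M₀` of the affine dual coset realises the character `ψ(λ(·))` of
`1 + 𝔫` as the restriction of a level-`k` function (so the obstruction above is the only one). -/
theorem levelLE_of_affineDual_witness (k : ℕ) (T : CMat p m →+ CMat p m) (lam : CMat p m →+ ZMod p)
    (M₀ : CMat p m) (hM₀ : M₀.rank ≤ k) (hwit : ∀ e : CMat p m, Matrix.trace (M₀ * T e) = lam (T e)) :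
    ∃ c : CMat p m → ℂ, (∀ M : CMat p m, k < M.rank → c M = 0) ∧
      ∀ e : CMat p m, fourierMat c (1 + T e) = ZMod.stdAddChar (lam (T e)) := by
  refine ⟨fun M => if M = M₀ then (ZMod.stdAddChar (- Matrix.trace M₀) : ℂ) else 0, ?_, ?_⟩
  · intro M hM
    show (if M = M₀ then _ else _) = (0 : ℂ)
    rw [if_neg]
    rintro rfl
    omega
  · intro e
    rw [fourierMat, Finset.sum_eq_single M₀ (fun M _ hM => by rw [if_neg hM, zero_mul])
      (fun h => absurd (Finset.mem_univ M₀) h), if_pos rfl, ← AddChar.map_add_eq_mul, Matrix.mul_add,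
      Matrix.mul_one, Matrix.trace_add, hwit e]
    congr 1
    ring

/-! ## The explicit instance: a position set containing a transposed `(k+1) × (k+1)` grid
(no new definitions: the pattern reader `n_e = Matrix.of fun a b => if (a, b) ∈ Pos then e a b else 0`, the grid
form `λ(n) = Σ_l n (γ l) (ρ l)` and the elementary matrices are written inline) -/

/-- `tr(M · E_{a₀ b₀}) = M_{b₀ a₀}`. [folklore] -/
theorem trace_mul_elem (M : CMat p m) (a₀ b₀ : Fin m) :
    Matrix.trace (M * (Matrix.of fun a b => if a = a₀ ∧ b = b₀ then (1 : ZMod p) else 0)) = M b₀ a₀ := by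
  simp only [Matrix.trace, Matrix.diag_apply, Matrix.mul_apply, Matrix.of_apply]
  rw [Finset.sum_eq_single b₀, Finset.sum_eq_single a₀]
  · simp
  · intro c _ hc
    rw [if_neg (fun h => hc h.1), mul_zero]
  · intro h; exact absurd (Finset.mem_univ _) h
  · intro a _ ha
    exact Finset.sum_eq_zero fun c _ => by rw [if_neg (fun h => ha h.2), mul_zero]
  · intro h; exact absurd (Finset.mem_univ _) h

/-- The grid form on an elementary matrix of the grid: `λ(E_{γ j, ρ i}) = [i = j]`. -/
theorem gridForm_elem {k : ℕ} (ρ γ : Fin (k + 1) → Fin m) (hρ : Function.Injective ρ)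
    (hγ : Function.Injective γ) (i j : Fin (k + 1)) :
    (∑ l : Fin (k + 1),
      (Matrix.of fun a b => if a = γ j ∧ b = ρ i then (1 : ZMod p) else 0 : CMat p m) (γ l) (ρ l)) =
      if i = j then 1 else 0 := by
  simp only [Matrix.of_apply]
  by_cases hij : i = j
  · subst hij
    rw [if_pos rfl, Finset.sum_eq_single i]
    · simp
    · intro l _ hl
      rw [if_neg]
      rintro ⟨_, h2⟩
      exact hl (hρ h2)
    · intro h; exact absurd (Finset.mem_univ _) h
  · rw [if_neg hij]
    refine Finset.sum_eq_zero fun l _ => ?_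
    rw [if_neg]
    rintro ⟨h1, h2⟩
    exact hij ((hρ h2).symm.trans (hγ h1))

/-- On the affine dual coset of the grid form every matrix restricts to the identity on `ρ × γ`, hence has
rank `≥ k + 1`. -/
theorem succ_le_rank_of_gridCoset {k : ℕ} (Pos : Finset (Fin m × Fin m)) (ρ γ : Fin (k + 1) → Fin m)
    (hρ : Function.Injective ρ) (hγ : Function.Injective γ) (hgrid : ∀ i j, (γ j, ρ i) ∈ Pos)
    (M : CMat p m)
    (hM : ∀ e : CMat p m,
      Matrix.trace (M * (Matrix.of fun a b => if (a, b) ∈ Pos then e a b else 0)) =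
        ∑ l : Fin (k + 1), (Matrix.of fun a b => if (a, b) ∈ Pos then e a b else 0 : CMat p m) (γ l) (ρ l)) :
    k + 1 ≤ M.rank := by
  have hentry : ∀ i j : Fin (k + 1), M (ρ i) (γ j) = if i = j then 1 else 0 := by
    intro i j
    have h := hM (Matrix.of fun a b => if a = γ j ∧ b = ρ i then (1 : ZMod p) else 0)
    have hT : (Matrix.of fun a b => if (a, b) ∈ Pos then
        (Matrix.of fun a b => if a = γ j ∧ b = ρ i then (1 : ZMod p) else 0 : CMat p m) a b else 0 : CMat p m) =
        Matrix.of fun a b => if a = γ j ∧ b = ρ i then (1 : ZMod p) else 0 := by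
      ext a b
      simp only [Matrix.of_apply]
      by_cases hab : a = γ j ∧ b = ρ i
      · obtain ⟨rfl, rfl⟩ := hab
        rw [if_pos (hgrid i j)]
      · rw [if_neg hab]
        split_ifs <;> rfl
    rw [hT, trace_mul_elem, gridForm_elem ρ γ hρ hγ] at h
    exact h
  have hsub : M.submatrix ρ γ = (1 : Matrix (Fin (k + 1)) (Fin (k + 1)) (ZMod p)) := by
    ext i j
    rw [Matrix.submatrix_apply, hentry, Matrix.one_apply]
  calc k + 1 = (1 : Matrix (Fin (k + 1)) (Fin (k + 1)) (ZMod p)).rank := by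
        rw [Matrix.rank_one, Fintype.card_fin]
    _ = (M.submatrix ρ γ).rank := by rw [hsub]
    _ ≤ M.rank := Matrix.rank_submatrix_le M ρ γ

/-- **NO LEVEL-`k` IDENTITY TEST ON A SET CONTAINING THE PATTERN POINTS `1 + n_e` OF A POSITION SET WITH A
TRANSPOSED `(k+1)`-GRID.** -/
theorem no_idTest_of_patGrid (k : ℕ) (Pos : Finset (Fin m × Fin m)) (ρ γ : Fin (k + 1) → Fin m)
    (hρ : Function.Injective ρ) (hγ : Function.Injective γ) (hgrid : ∀ i j, (γ j, ρ i) ∈ Pos)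
    (S : Set (CMat p m))
    (hS : ∀ e : CMat p m, 1 + (Matrix.of fun a b => if (a, b) ∈ Pos then e a b else 0 : CMat p m) ∈ S)
    (c : CMat p m → ℂ) (hc : ∀ M : CMat p m, k < M.rank → c M = 0)
    (h1 : fourierMat c 1 = 1) (h0 : ∀ s ∈ S, s ≠ 1 → fourierMat c s = 0) : False := by
  let T : CMat p m →+ CMat p m := AddMonoidHom.mk'
    (fun e : CMat p m => (Matrix.of fun a b => if (a, b) ∈ Pos then e a b else 0 : CMat p m)) (by
      intro x y
      ext a b
      simp only [Matrix.of_apply, Matrix.add_apply]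
      split_ifs <;> simp)
  let lam : CMat p m →+ ZMod p := AddMonoidHom.mk'
    (fun n : CMat p m => ∑ l : Fin (k + 1), n (γ l) (ρ l)) (by
      intro x y
      simp [Finset.sum_add_distrib])
  have hT : ∀ e, T e = (Matrix.of fun a b => if (a, b) ∈ Pos then e a b else 0 : CMat p m) := fun e => rfl
  have hlam : ∀ n, lam n = ∑ l : Fin (k + 1), n (γ l) (ρ l) := fun n => rfl
  refine no_idTest_of_affineDual k T lam ?_ S (fun e => by rw [hT]; exact hS e) c hc h1 h0
  intro M hM
  by_contra hall
  push Not at hall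
  have := succ_le_rank_of_gridCoset Pos ρ γ hρ hγ hgrid M (fun e => by rw [← hT, ← hlam]; exact hall e)
  omega

/-- `det (1 + n_e) = 1` when `Pos` is strictly lower triangular. -/
theorem det_one_add_patLow (Pos : Finset (Fin m × Fin m)) (hlow : ∀ ab ∈ Pos, ab.2.val < ab.1.val)
    (e : CMat p m) :
    (1 + (Matrix.of fun a b => if (a, b) ∈ Pos then e a b else 0 : CMat p m)).det = 1 := by
  have hz : ∀ a b : Fin m, a.val ≤ b.val →
      (Matrix.of fun a b => if (a, b) ∈ Pos then e a b else 0 : CMat p m) a b = 0 := by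
    intro a b hab
    simp only [Matrix.of_apply]
    rw [if_neg]
    intro hmem
    have := hlow _ hmem
    simp only at this
    omega
  have htri : (1 + (Matrix.of fun a b => if (a, b) ∈ Pos then e a b else 0 : CMat p m)).BlockTriangular
      OrderDual.toDual := by
    intro a b hlt
    have hlt' : a < b := by simpa using hlt
    rw [Matrix.add_apply, Matrix.one_apply_ne (ne_of_lt hlt'), hz a b (le_of_lt hlt'), add_zero]
  rw [Matrix.det_of_lowerTriangular _ htri]
  refine Finset.prod_eq_one fun a _ => ?_
  rw [Matrix.add_apply, Matrix.one_apply_eq, hz a a le_rfl, add_zero]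

/-- **DESIGN FILTER (pattern grid / abelian radical).**  In `GL_m(𝔽_p)`: if `H₁` contains every unipotent `u`
with `u − 1` supported on a strictly-lower position set `Pos` that contains a transposed `(k+1) × (k+1)` grid
`{(γ j, ρ i)}` (`ρ, γ` injective) — e.g. `H₁ ⊇ {[[1,0],[X,1]] : X ∈ M_{b×a}(𝔽_p)}` with `min(a,b) ≥ k + 1` — then
`(H₁, H₂, H₃)` admits NO level-`k` identity design (the crux's Fourier clause), whatever `H₂, H₃` are and
whatever the prime `p`.  No TPP, torus or triangle is needed. -/
theorem no_levelK_design_of_patGrid (k : ℕ) (Pos : Finset (Fin m × Fin m))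
    (hlow : ∀ ab ∈ Pos, ab.2.val < ab.1.val) (ρ γ : Fin (k + 1) → Fin m)
    (hρ : Function.Injective ρ) (hγ : Function.Injective γ) (hgrid : ∀ i j, (γ j, ρ i) ∈ Pos)
    {H₁ H₂ H₃ : Subgroup (Matrix.GeneralLinearGroup (Fin m) (ZMod p))}
    (hQ : ∀ u : Matrix.GeneralLinearGroup (Fin m) (ZMod p),
      (∀ a b : Fin m, ((u : CMat p m) - 1) a b ≠ 0 → (a, b) ∈ Pos) → u ∈ H₁)
    (hid : ∃ c : CMat p m → ℂ, (∀ M : CMat p m, k < M.rank → c M = 0) ∧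
      (∑ M : CMat p m, c M * ZMod.stdAddChar (Matrix.trace
        (M * ((1 : Matrix.GeneralLinearGroup (Fin m) (ZMod p)) : CMat p m)))) = 1 ∧
      ∀ a ∈ H₁, ∀ b ∈ H₂, ∀ g ∈ H₃, a * b * g ≠ 1 →
        (∑ M : CMat p m, c M * ZMod.stdAddChar (Matrix.trace
          (M * ((a * b * g : Matrix.GeneralLinearGroup (Fin m) (ZMod p)) : CMat p m)))) = 0) :
    False := by
  obtain ⟨c, hc, h1, h0⟩ := hid
  let S : Set (CMat p m) := {s | ∃ a ∈ H₁, ∃ b ∈ H₂, ∃ g ∈ H₃,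
    s = ((a * b * g : Matrix.GeneralLinearGroup (Fin m) (ZMod p)) : CMat p m)}
  refine no_idTest_of_patGrid k Pos ρ γ hρ hγ hgrid S ?_ c hc ?_ ?_
  · intro e
    let u : Matrix.GeneralLinearGroup (Fin m) (ZMod p) :=
      Matrix.GeneralLinearGroup.mkOfDetNeZero
        (1 + (Matrix.of fun a b => if (a, b) ∈ Pos then e a b else 0 : CMat p m))
        (by rw [det_one_add_patLow Pos hlow]; exact one_ne_zero)
    have hu : (u : CMat p m) = 1 + (Matrix.of fun a b => if (a, b) ∈ Pos then e a b else 0 : CMat p m) :=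
      rfl
    have huH : u ∈ H₁ := by
      refine hQ u fun a b hab => ?_
      rw [hu, add_sub_cancel_left] at hab
      simp only [Matrix.of_apply] at hab
      by_contra hmem
      exact hab (if_neg hmem)
    refine ⟨u, huH, 1, H₂.one_mem, 1, H₃.one_mem, ?_⟩
    rw [mul_one, mul_one, hu]
  · simpa [fourierMat] using h1
  · rintro s ⟨a, ha, b, hb, g, hg, rfl⟩ hs
    refine h0 a ha b hb g hg fun h => hs ?_
    rw [h, Matrix.GeneralLinearGroup.coe_one]

end Summit.MatrixMultiplication.MatrixMultiplication.Theorems.SubgroupIdentityDesigns.Negative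

end
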